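import Summits.ResolutionOfSingularities.ResolutionOfSingularities.Cruxes.DescentPerfectToAll.Disproof
import Summits.ResolutionOfSingularities.ResolutionOfSingularities.Theorems.DescentDescentPerfectToAllRobustModel
import Summits.ResolutionOfSingularities.ResolutionOfSingularities.Theorems.DescentDescentPerfectToAllFgModel
import Summits.ResolutionOfSingularities.ResolutionOfSingularities.Theorems.DescentDescentPerfectToAllExhaustion

/-!
# `DescentPerfectToAll` (stmt-ResolutionOfSingularities-0549) — lens 6: NEGATION AT CRUX LEVEL

Planner workfile (unit `res-B-lens-6-g0`, LADDER-RESOLUTION rung B, D-0159). No `sorry`.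
Resolution of singularities in characteristic `p` is NOT proved anywhere in this file or this tree;
rung B lives in dimension ≥ 4 and nothing here is «progress on resolution».

## What the KEY asked
«push toward a typed `H` with `H → ¬DescentPerfectToAll` (a dim ≥ 4 `X` over a field of infinite
p-rank not separably generated over any perfect subfield, whose EVERY f.g.-model resolution
re-singularises under the coefficient extension) OR prove that every such `H` already implies `¬R0`.»

## What this file certifies (all kernel-checked; the one non-landed standard input is the NAMED
hypothesis `ResolutionDescendsToLevel`, EGA IV₃ 8.8.2 + 8.10.5, used only where stated)

* §1 the KEY's geometric obstruction, TYPED: `RobustAtLevel`, `NoRobustLevel` (census p1 §5 «Q1∞»: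
  the wound tower over a fixed model never stabilises), `AllModelsWound k X` (every finitely
  generated level of every model of `X` is wounded), `KeyH p` (some reduced separated f.t. `X/k`,
  `char k = p`, with `AllModelsWound k X`).
* §2 UNCONDITIONALLY: `¬ HasResolution X → AllModelsWound k X` (contrapositive of the landed
  `Theorems.stub_resolutionOfRobustModel`), hence `¬ ResolutionInChar p → KeyH p`; and modulo
  `ResolutionDescendsToLevel`: `AllModelsWound k X → ¬ HasResolution X` (with the landed
  `Theorems.stub_fgModel`), hence `KeyH p ↔ ¬ ResolutionInChar p` and `KeyH p → ¬ summit`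
  WITHOUT any use of `PerfectRes p`. THE KEY's SECOND ALTERNATIVE HOLDS: every such `H` is `¬R0`.
* §3 NEGATIVE DOMINATION of rung B: `¬ crux ↔ ∃ p prime, PerfectRes p ∧ KeyH p`;
  prime-locally `(KeyH p → ¬ CruxAt p) ↔ (KeyH p → PerfectRes p)` — a geometric obstruction refutes
  rung B at `p` IFF it also PROVES resolution over all perfect fields of characteristic `p`; given
  `KeyH p`, rung B at `p` is (vacuously) TRUE exactly when the perfect-field conjecture fails at `p`
  (`keyH_dichotomy`). So `¬B` is strictly harder to reach than `¬R0`: it is `¬R0(p) ∧ PerfectRes(p)`.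
* §4 the KEY's qualifiers are WLOG, not strength: the residual normal form
  `¬ crux ↔ ∃ p prime, PerfectRes p ∧ ∃ k countable, NOT EFT-separably exhausted, ∃ X/k reduced
  separated f.t. with AllModelsWound k X` (from the landed `Theorems.descentPerfectToAll_iff_residual`),
  and `dim X ≥ 4` given the vendored `CossartPiltant2019` (`Disproof.crux_iff_dim_gt_three`).

Conclusion for the LADDER (row B, negative side): no hypothesis short of a counterexample to
resolution in characteristic `p` (dim ≥ 4, imperfect non-residually-exhausted ground field) bears on
`¬B`, and even that counterexample refutes B only together with a PROOF of `PerfectRes p`.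
-/

noncomputable section

set_option linter.dupNamespace false

open AlgebraicGeometry CategoryTheory CategoryTheory.Limits
open Literature.AlgebraicGeometry.Resolution

namespace Summit.ResolutionOfSingularities.ResolutionOfSingularities.Cruxes.DescentPerfectToAll.NegationLens6

/-! ## §1 The geometric obstruction of the KEY, typed -/

/-- The model `f₀ : X₀ → Spec K₀` is ROBUST AT THE LEVEL `L ⊇ K₀` (subfields of `k`): the level
`X₀ ×_{K₀} L` has a proper birational `π : Y → X₀ ×_{K₀} L` whose coefficient extension `Y ×_L k` is
regular (an un-wounded resolution). -/
def RobustAtLevel {k : Type} [Field k] {K₀ : Subfield k} {X₀ : Scheme.{0}} (f₀ : X₀ ⟶ Spec (.of K₀))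
    (L : Subfield k) (hL : K₀ ≤ L) : Prop :=
  ∃ (Y : Scheme.{0}) (π : Y ⟶ pullback f₀ (Spec.map (CommRingCat.ofHom (Subfield.inclusion hL)))),
    IsProper π ∧ IsBirational π ∧
      Scheme.IsRegular (pullback (π ≫ pullback.snd f₀ (Spec.map (CommRingCat.ofHom (Subfield.inclusion hL))))
        (Spec.map (CommRingCat.ofHom L.subtype)))

/-- «Q1∞» of census p1 §5 for the model `X₀/K₀`: NO finitely generated level `L ⊇ K₀` inside `k` is
robust — every resolution of every f.g. level is wounded by `⊗ k`, i.e. the tower of wound-forcing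
enlargements never stabilises. -/
def NoRobustLevel {k : Type} [Field k] {K₀ : Subfield k} {X₀ : Scheme.{0}} (f₀ : X₀ ⟶ Spec (.of K₀)) :
    Prop :=
  ∀ (L : Subfield k) (hL : K₀ ≤ L) (t : Finset k), L = Subfield.closure (↑t : Set k) → ¬ RobustAtLevel f₀ L hL

/-- The KEY's `H` for a scheme `X` and a coefficient field `k`: EVERY finitely generated model
`X ≅ X₀ ×_{K₀} k` (`K₀ = closure s` f.g., `X₀/K₀` separated of finite type) has NO robust finitely
generated level — «every f.g.-model resolution re-singularises under the coefficient extension». -/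
def AllModelsWound (k : Type) [Field k] (X : Scheme.{0}) : Prop :=
  ∀ (K₀ : Subfield k) (s : Finset k), K₀ = Subfield.closure (↑s : Set k) →
    ∀ (X₀ : Scheme.{0}) (f₀ : X₀ ⟶ Spec (.of K₀)), IsSeparated f₀ → LocallyOfFiniteType f₀ →
      QuasiCompact f₀ → Nonempty (X ≅ pullback f₀ (Spec.map (CommRingCat.ofHom K₀.subtype))) →
        NoRobustLevel f₀

/-- The KEY's hypothesis at the prime `p`: some reduced separated scheme of finite type over some field
of characteristic `p` all of whose f.g.-model resolutions are wounded. (The KEY's further qualifiers —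
`dim X ≥ 4`, `k` of infinite `p`-rank / not separably generated over a perfect subfield — are WLOG
reductions, §4, not additional strength.) -/
def KeyH (p : ℕ) : Prop :=
  ∃ (k : Type) (_ : Field k) (_ : CharP k p) (X : Scheme.{0}) (f : X ⟶ Spec (.of k)),
    IsSeparated f ∧ LocallyOfFiniteType f ∧ QuasiCompact f ∧ IsReduced X ∧ AllModelsWound k X

/-- LIMIT DESCENT OF A RESOLUTION TO A FINITELY GENERATED LEVEL — the one standard input not yet in
the tree in this form (EGA IV₃ 8.8.2 (ii) + 8.10.5 (xii) for the proper morphism over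
`X₀ ×_{K₀} k = lim_L X₀ ×_{K₀} L`, `L` over the f.g. subfields of `k` containing `K₀`; the open of
isomorphy and the two densities descend after enlarging `L` (8.10.5 (i), faithful flatness of
`X_k → X_L`); regularity of `Y_L ×_L k ≅ Z` is that of the given resolution source `Z`). TRUE, standard;
the companion crux 0550's adversary file types the same step as `LimitDescentOfResolutions`.
Used below ONLY as an explicit hypothesis `(hlim : ResolutionDescendsToLevel)`. -/
def ResolutionDescendsToLevel : Prop :=
  ∀ (k : Type) [Field k] (K₀ : Subfield k) (s : Finset k), K₀ = Subfield.closure (↑s : Set k) →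
    ∀ (X₀ : Scheme.{0}) (f₀ : X₀ ⟶ Spec (.of K₀)), IsSeparated f₀ → LocallyOfFiniteType f₀ →
      QuasiCompact f₀ → Scheme.HasResolution (pullback f₀ (Spec.map (CommRingCat.ofHom K₀.subtype))) →
        ∃ (L : Subfield k) (hL : K₀ ≤ L) (t : Finset k), L = Subfield.closure (↑t : Set k) ∧
          RobustAtLevel f₀ L hL

/-! ## §2 The obstruction is `¬ HasResolution`, hence `¬R0` — no `PerfectRes` anywhere -/

/-- A robust level resolves the top: `RobustAtLevel f₀ L hL → HasResolution (X₀ ×_{K₀} k)`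
(the landed `Theorems.stub_resolutionOfRobustModel`). -/
theorem hasResolution_of_robustAtLevel {k : Type} [Field k] {K₀ : Subfield k} {X₀ : Scheme.{0}}
    (f₀ : X₀ ⟶ Spec (.of K₀)) (hs : IsSeparated f₀) (hl : LocallyOfFiniteType f₀) (hq : QuasiCompact f₀)
    {L : Subfield k} {hL : K₀ ≤ L} (h : RobustAtLevel f₀ L hL) :
    Scheme.HasResolution (pullback f₀ (Spec.map (CommRingCat.ofHom K₀.subtype))) := by
  obtain ⟨Y, π, hp, hb, hr⟩ := h
  exact Theorems.stub_resolutionOfRobustModel k K₀ L hL X₀ f₀ hs hl hq Y π hp hb hr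

/-- UNCONDITIONAL: if the top `X₀ ×_{K₀} k` has no resolution then no f.g. level is robust («Q1∞»). -/
theorem noRobustLevel_of_not_hasResolution {k : Type} [Field k] {K₀ : Subfield k} {X₀ : Scheme.{0}}
    (f₀ : X₀ ⟶ Spec (.of K₀)) (hs : IsSeparated f₀) (hl : LocallyOfFiniteType f₀) (hq : QuasiCompact f₀)
    (hX : ¬ Scheme.HasResolution (pullback f₀ (Spec.map (CommRingCat.ofHom K₀.subtype)))) :
    NoRobustLevel f₀ :=
  fun _ _ _ _ h => hX (hasResolution_of_robustAtLevel f₀ hs hl hq h)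

/-- Modulo limit descent: «Q1∞» for a model forces the top to have NO resolution. -/
theorem not_hasResolution_of_noRobustLevel (hlim : ResolutionDescendsToLevel) {k : Type} [Field k]
    {K₀ : Subfield k} (s : Finset k) (hK₀ : K₀ = Subfield.closure (↑s : Set k)) {X₀ : Scheme.{0}}
    (f₀ : X₀ ⟶ Spec (.of K₀)) (hs : IsSeparated f₀) (hl : LocallyOfFiniteType f₀) (hq : QuasiCompact f₀)
    (h : NoRobustLevel f₀) :
    ¬ Scheme.HasResolution (pullback f₀ (Spec.map (CommRingCat.ofHom K₀.subtype))) := by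
  intro hX
  obtain ⟨L, hL, t, hLt, hrob⟩ := hlim k K₀ s hK₀ X₀ f₀ hs hl hq hX
  exact h L hL t hLt hrob

/-- «Q1∞» ⟺ the top has no resolution (modulo limit descent): an infinite wound tower over a FIXED
model is a counterexample to resolution of `X₀ ×_{K₀} k`, nothing less. -/
theorem noRobustLevel_iff_not_hasResolution (hlim : ResolutionDescendsToLevel) {k : Type} [Field k]
    {K₀ : Subfield k} (s : Finset k) (hK₀ : K₀ = Subfield.closure (↑s : Set k)) {X₀ : Scheme.{0}}
    (f₀ : X₀ ⟶ Spec (.of K₀)) (hs : IsSeparated f₀) (hl : LocallyOfFiniteType f₀) (hq : QuasiCompact f₀) :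
    NoRobustLevel f₀ ↔ ¬ Scheme.HasResolution (pullback f₀ (Spec.map (CommRingCat.ofHom K₀.subtype))) :=
  ⟨not_hasResolution_of_noRobustLevel hlim s hK₀ f₀ hs hl hq,
    noRobustLevel_of_not_hasResolution f₀ hs hl hq⟩

/-- UNCONDITIONAL: a scheme without resolution has all its f.g. models wounded at every f.g. level. -/
theorem allModelsWound_of_not_hasResolution {k : Type} [Field k] {X : Scheme.{0}}
    (hX : ¬ Scheme.HasResolution X) : AllModelsWound k X := by
  intro K₀ s _ X₀ f₀ hs hl hq e
  obtain ⟨e⟩ := e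
  refine noRobustLevel_of_not_hasResolution f₀ hs hl hq fun hres => hX ?_
  exact hres.of_iso e.inv

/-- Modulo limit descent: `AllModelsWound k X` for a reduced separated f.t. `X/k` forces
`¬ HasResolution X` (a finitely generated model exists by the landed `Theorems.stub_fgModel`). -/
theorem not_hasResolution_of_allModelsWound (hlim : ResolutionDescendsToLevel) {k : Type} [Field k]
    {X : Scheme.{0}} (f : X ⟶ Spec (.of k)) (hs : IsSeparated f) (hl : LocallyOfFiniteType f)
    (hq : QuasiCompact f) (hr : IsReduced X) (h : AllModelsWound k X) : ¬ Scheme.HasResolution X := by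
  intro hX
  obtain ⟨K₀, s, hK₀, X₀, f₀, h₁, h₂, h₃, -, ⟨e⟩⟩ := Theorems.stub_fgModel k X f hs hl hq hr
  exact not_hasResolution_of_noRobustLevel hlim s hK₀ f₀ h₁ h₂ h₃ (h K₀ s hK₀ X₀ f₀ h₁ h₂ h₃ ⟨e⟩)
    (hX.of_iso e.hom)

/-- THE TYPED `H` IS `¬ HasResolution` (modulo limit descent). -/
theorem allModelsWound_iff_not_hasResolution (hlim : ResolutionDescendsToLevel) {k : Type} [Field k]
    {X : Scheme.{0}} (f : X ⟶ Spec (.of k)) (hs : IsSeparated f) (hl : LocallyOfFiniteType f)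
    (hq : QuasiCompact f) (hr : IsReduced X) : AllModelsWound k X ↔ ¬ Scheme.HasResolution X :=
  ⟨not_hasResolution_of_allModelsWound hlim f hs hl hq hr, allModelsWound_of_not_hasResolution⟩

/-- UNCONDITIONAL: a failure of resolution in characteristic `p` IS an instance of the KEY's `H`. -/
theorem keyH_of_not_resolutionInChar {p : ℕ} (h : ¬ ResolutionInChar.{0} p) : KeyH p := by
  unfold ResolutionInChar at h
  push Not at h
  obtain ⟨k, _, _, X, f, hs, hl, hq, hr, hX⟩ := h
  exact ⟨k, ‹_›, ‹_›, X, f, hs, hl, hq, hr, allModelsWound_of_not_hasResolution hX⟩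

/-- Modulo limit descent: the KEY's `H` at `p` refutes resolution in characteristic `p` — `¬R0` —
with NO use of resolution over perfect fields. -/
theorem not_resolutionInChar_of_keyH (hlim : ResolutionDescendsToLevel) {p : ℕ} (h : KeyH p) :
    ¬ ResolutionInChar.{0} p := by
  obtain ⟨k, _, _, X, f, hs, hl, hq, hr, hw⟩ := h
  exact fun hR => not_hasResolution_of_allModelsWound hlim f hs hl hq hr hw (hR k X f hs hl hq hr)

/-- `KeyH p ↔ ¬ ResolutionInChar p` (modulo limit descent): the KEY's geometric obstruction is a
counterexample to resolution in characteristic `p` in costume — the second alternative of the KEY. -/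
theorem keyH_iff_not_resolutionInChar (hlim : ResolutionDescendsToLevel) {p : ℕ} :
    KeyH p ↔ ¬ ResolutionInChar.{0} p :=
  ⟨not_resolutionInChar_of_keyH hlim, keyH_of_not_resolutionInChar⟩

/-- … hence `H ⇒ ¬ summit` (`¬R0`), prime by prime. -/
theorem not_summit_of_keyH (hlim : ResolutionDescendsToLevel) {p : ℕ} (hp : p.Prime) (h : KeyH p) :
    ¬ _root_.ResolutionOfSingularities :=
  fun hS => not_resolutionInChar_of_keyH hlim h ((_root_.ResolutionOfSingularities_iff.mp hS) p hp)

/-! ## §3 Negative domination of rung B -/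

/-- The crux at one prime. -/
def CruxAt (p : ℕ) : Prop := Disproof.PerfectRes p → ResolutionInChar.{0} p

/-- The crux is the conjunction of its prime-local instances. [folklore] -/
theorem crux_iff_cruxAt : Disproof.Crux ↔ ∀ p : ℕ, p.Prime → CruxAt p := Iff.rfl

/-- UNCONDITIONAL: a refutation of the crux yields a prime with `PerfectRes p ∧ KeyH p`. -/
theorem exists_perfectRes_and_keyH_of_not_crux (h : ¬ Disproof.Crux) :
    ∃ p : ℕ, p.Prime ∧ Disproof.PerfectRes p ∧ KeyH p := by
  obtain ⟨p, hp, hP, hR⟩ := Disproof.not_crux_iff.mp h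
  exact ⟨p, hp, hP, keyH_of_not_resolutionInChar hR⟩

/-- **NEGATIVE NORMAL FORM OF RUNG B** (modulo limit descent):
`¬ DescentPerfectToAll ↔ ∃ p prime, PerfectRes p ∧ KeyH p`. The KEY's `H` enters `¬B` only
TOGETHER WITH a proof of resolution over all perfect fields of the same characteristic. -/
theorem not_crux_iff_perfectRes_and_keyH (hlim : ResolutionDescendsToLevel) :
    ¬ Disproof.Crux ↔ ∃ p : ℕ, p.Prime ∧ Disproof.PerfectRes p ∧ KeyH p := by
  refine ⟨exists_perfectRes_and_keyH_of_not_crux, fun ⟨p, hp, hP, hH⟩ hC => ?_⟩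
  exact not_resolutionInChar_of_keyH hlim hH (hC p hp hP)

/-- Prime-local normal form (modulo limit descent). -/
theorem not_cruxAt_iff (hlim : ResolutionDescendsToLevel) {p : ℕ} :
    ¬ CruxAt p ↔ Disproof.PerfectRes p ∧ KeyH p := by
  unfold CruxAt
  rw [keyH_iff_not_resolutionInChar hlim]
  push Not
  rfl

/-- UNCONDITIONAL: where the perfect-field conjecture fails, rung B holds vacuously. [folklore] -/
theorem cruxAt_of_not_perfectRes {p : ℕ} (h : ¬ Disproof.PerfectRes p) : CruxAt p :=
  fun hP => absurd hP h

/-- **DICHOTOMY** (modulo limit descent): given the KEY's `H` at `p`, rung B at `p` is FALSE iff the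
perfect-field conjecture HOLDS at `p`, and (vacuously) TRUE iff it FAILS at `p`. A negation seat
holding `H` learns nothing about B without settling `PerfectRes p`. -/
theorem keyH_dichotomy (hlim : ResolutionDescendsToLevel) {p : ℕ} (h : KeyH p) :
    (Disproof.PerfectRes p ∧ ¬ CruxAt p) ∨ (¬ Disproof.PerfectRes p ∧ CruxAt p) := by
  by_cases hP : Disproof.PerfectRes p
  · exact Or.inl ⟨hP, fun hC => not_resolutionInChar_of_keyH hlim h (hC hP)⟩
  · exact Or.inr ⟨hP, cruxAt_of_not_perfectRes hP⟩

/-- **NO OBSTRUCTION SHORT OF `PerfectRes` SEPARATES B FROM R0** (modulo limit descent): an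
implication `KeyH p → ¬ CruxAt p` is EXACTLY an implication `KeyH p → PerfectRes p` — a geometric
obstruction refutes rung B at `p` iff it proves resolution over every perfect field of
characteristic `p`. -/
theorem keyH_refutes_cruxAt_iff (hlim : ResolutionDescendsToLevel) {p : ℕ} :
    (KeyH p → ¬ CruxAt p) ↔ (KeyH p → Disproof.PerfectRes p) := by
  refine ⟨fun h hH => ((not_cruxAt_iff hlim).mp (h hH)).1, fun h hH hC => ?_⟩
  exact not_resolutionInChar_of_keyH hlim hH (hC (h hH))

/-- UNCONDITIONAL half of the same: any `H` at all with `H → ¬ CruxAt p` proves `PerfectRes p`. -/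
theorem perfectRes_of_refutes_cruxAt {p : ℕ} {H : Prop} (h : H → ¬ CruxAt p) (hH : H) :
    Disproof.PerfectRes p := by
  by_contra hP
  exact h hH (cruxAt_of_not_perfectRes hP)

/-- UNCONDITIONAL: and any `H` with `H → ¬ crux` proves `PerfectRes p ∧ ¬ ResolutionInChar p` at some
prime — i.e. contains a counterexample to the summit (`¬R0`) AND the perfect-field theorem there. -/
theorem summitCounterexample_of_refutes_crux {H : Prop} (h : H → ¬ Disproof.Crux) (hH : H) :
    (∃ p : ℕ, p.Prime ∧ Disproof.PerfectRes p ∧ ¬ ResolutionInChar.{0} p) ∧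
      ¬ _root_.ResolutionOfSingularities :=
  ⟨Disproof.not_crux_iff.mp (h hH), Disproof.not_summit_of_not_crux (h hH)⟩

/-! ## §4 The KEY's qualifiers are WLOG reductions of `¬B`, not extra strength -/

/-- `k` is EFT-SEPARABLY EXHAUSTED (verbatim the class of the landed
`Theorems.hasResolution_of_perfectRes_of_exhaustedByEssFiniteType`): every finite subset of `k` lies
in a subfield `E` essentially of finite type over a perfect field with `k/E` Mac Lane separable.
Its negation is the KEY's «not separably generated over any perfect subfield» (made level-wise). -/
def EFTSeparablyExhausted (p : ℕ) (k : Type) [Field k] : Prop :=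
  ∀ s : Finset k, ∃ (k₀ : Type) (_ : Field k₀) (_ : PerfectField k₀) (E : Subfield k)
    (_ : Algebra k₀ E), Algebra.EssFiniteType k₀ E ∧ (↑s : Set k) ⊆ E ∧
      ∀ u : Finset k, LinearIndepOn E _root_.id (↑u : Set k) →
        LinearIndepOn E (fun x : k => x ^ p) (↑u : Set k)

/-- The crux restricted to countable, non-exhausted ground fields (landed:
`Theorems.descentPerfectToAll_iff_residual`), by name. [folklore] -/
theorem crux_iff_residual :
    Disproof.Crux ↔ ∀ p : ℕ, p.Prime → Disproof.PerfectRes p →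
      ∀ (k : Type) [Field k] [CharP k p], Countable k → ¬ EFTSeparablyExhausted p k →
        ∀ (X : Scheme.{0}) (f : X ⟶ Spec (.of k)), IsSeparated f → LocallyOfFiniteType f →
          QuasiCompact f → IsReduced X → Scheme.HasResolution X :=
  Theorems.descentPerfectToAll_iff_residual

/-- **RESIDUAL NEGATIVE NORMAL FORM** (modulo limit descent): `¬B` is EXACTLY the KEY's picture —
a prime `p` with `PerfectRes p`, a COUNTABLE field `k` of characteristic `p` that is NOT EFT-separably
exhausted (infinite `p`-rank territory: no finite stage separably generated over an EFT-over-perfect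
subfield), and a reduced separated f.t. `X/k` ALL of whose f.g.-model resolutions are wounded.
The qualifiers cost nothing and buy nothing: they are consequences of `¬B`, and the last conjunct is
`¬ HasResolution X` (§2). -/
theorem not_crux_iff_residual (hlim : ResolutionDescendsToLevel) :
    ¬ Disproof.Crux ↔ ∃ p : ℕ, p.Prime ∧ Disproof.PerfectRes p ∧
      ∃ (k : Type) (_ : Field k) (_ : CharP k p), Countable k ∧ ¬ EFTSeparablyExhausted p k ∧
        ∃ (X : Scheme.{0}) (f : X ⟶ Spec (.of k)), IsSeparated f ∧ LocallyOfFiniteType f ∧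
          QuasiCompact f ∧ IsReduced X ∧ AllModelsWound k X := by
  rw [crux_iff_residual]
  push Not
  constructor
  · rintro ⟨p, hp, hP, k, _, _, hk, hE, X, f, hs, hl, hq, hr, hX⟩
    exact ⟨p, hp, hP, k, ‹_›, ‹_›, hk, hE, X, f, hs, hl, hq, hr, allModelsWound_of_not_hasResolution hX⟩
  · rintro ⟨p, hp, hP, k, _, _, hk, hE, X, f, hs, hl, hq, hr, hw⟩
    exact ⟨p, hp, hP, k, ‹_›, ‹_›, hk, hE, X, f, hs, hl, hq, hr,
      not_hasResolution_of_allModelsWound hlim f hs hl hq hr hw⟩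

/-- … and `dim X ≥ 4` given the vendored `CossartPiltant2019` (unconditional direction: a refutation
of the crux produces `H` on a scheme of dimension `> 3`). [cite: CossartPiltant2019, Thm. 1.1] -/
theorem exists_keyH_dimGtThree_of_not_crux (hCP : CossartPiltant2019.{0}) (h : ¬ Disproof.Crux) :
    ∃ p : ℕ, p.Prime ∧ Disproof.PerfectRes p ∧
      ∃ (k : Type) (_ : Field k) (_ : CharP k p) (X : Scheme.{0}) (f : X ⟶ Spec (.of k)),
        IsSeparated f ∧ LocallyOfFiniteType f ∧ QuasiCompact f ∧ IsReduced X ∧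
          3 < topologicalKrullDim X ∧ AllModelsWound k X := by
  rw [Disproof.crux_iff_dim_gt_three hCP] at h
  push Not at h
  obtain ⟨p, hp, hP, hR⟩ := h
  unfold Disproof.ResolutionInCharDimGtThree at hR
  push Not at hR
  obtain ⟨k, _, _, X, f, hs, hl, hq, hr, hdim, hX⟩ := hR
  exact ⟨p, hp, hP, k, ‹_›, ‹_›, X, f, hs, hl, hq, hr, hdim, allModelsWound_of_not_hasResolution hX⟩

/-- SHARPENING OF THE KEY'S WORDING («infinite p-rank» is NOT forced). ON PAPER — stated, not
proved, in this file: there is a COUNTABLE field of characteristic `p` of `p`-RANK ONE (`{t}` a `p`-basis)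
that is NOT EFT-separably exhausted. Witness: inside `𝔽_p((t))` (whose `p`-basis is `{t}` and whose
maximal perfect subfield is `⋂ₙ 𝔽_p((t^{pⁿ})) = 𝔽_p`) take `u ∈ 𝔽_p[[t]]` transcendental over `𝔽_p(t)`
and let `k` be the smallest subfield containing `t, u` and closed under taking the coordinates `x_j`
of `x = Σ_{j<p} t^j x_j^p`; then `k = ⊕_{j<p} t^j k^p`, `t ∉ k^p`, `k` countable, and for `s = {t, u}`
every subfield `E ∋ t, u` essentially of finite type over a perfect `k₀` (necessarily algebraic over
`𝔽_p`) has `[E : E^p] = p^{trdeg E} ≥ p²`, so `k/E` is inseparable (Mac Lane: a `p`-basis of `E` would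
stay `p`-independent in `k`, forcing `[k : k^p] ≥ p²`). Consequence for the LADDER wording of `¬B`:
the minimal counterexample field may have `p`-rank `1`; Cossart–Piltant 2008/2009-type hypotheses
(`k` differentially finite over a perfect subfield ⟺ `[k : k^p] < ∞`) do NOT exclude the residual
class. -/
def ExistsResidualFieldOfPRankOne (p : ℕ) : Prop :=
  ∃ (k : Type) (_ : Field k) (_ : CharP k p), Countable k ∧
    (∃ t : k, (∀ c : k, c ^ p ≠ t) ∧ ∀ x : k, ∃ c : Fin p → k, x = ∑ j : Fin p, t ^ (j : ℕ) * c j ^ p) ∧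
      ¬ EFTSeparablyExhausted p k

/-! ## §5 Domination table — which statements around rung B a negation seat can refute at all

A statement `T` with `summit → T` is NEGATIVELY DOMINATED: `¬T → ¬summit`, so refuting it costs a
counterexample to resolution in characteristic `p` (dim ≥ 4). All four route-level statements of the
Descent route are of this kind (certified below), as is every prime-local / residual / countable
restriction of the crux (§3–§4). Negation has teeth ONLY on statements NOT implied by the summit —
mechanism-specific stubs of live lines (e.g. `Theses.RadicialJung.CleanModels`, stmt-15917; the GNF stub
stmt-18001; fixed-level robustness `OneRootRobustAtFixedLevel`, already refuted in
`Theorems/DescentPerfectToAll/Negative/`), which assert MORE than resolution. -/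

/-- Negative domination: a summit consequence is refutable only by refuting the summit. [folklore] -/
theorem negDominated {T : Prop} (h : _root_.ResolutionOfSingularities → T) :
    ¬ T → ¬ _root_.ResolutionOfSingularities :=
  mt h

/-- summit ⇒ `DescentPerfectToAll` (rung B). [folklore] -/
theorem summit_imp_descentPerfectToAll :
    _root_.ResolutionOfSingularities → Theses.Descent.DescentPerfectToAll :=
  fun hS p hp _ => (_root_.ResolutionOfSingularities_iff.mp hS) p hp

/-- summit ⇒ `DescentAlgclosedToPerfect` (companion crux 0550). [folklore] -/
theorem summit_imp_descentAlgclosedToPerfect :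
    _root_.ResolutionOfSingularities → Theses.Descent.DescentAlgclosedToPerfect :=
  fun hS p hp _ k _ _ _ X f a b c d => (_root_.ResolutionOfSingularities_iff.mp hS) p hp k X f a b c d

/-- summit ⇒ `DescentThesis` (0547). [folklore] -/
theorem summit_imp_descentThesis :
    _root_.ResolutionOfSingularities → Theses.Descent.DescentThesis := by
  intro hS p hp k _ _ _ X f a b c d
  haveI := d
  exact (_root_.ResolutionOfSingularities_iff.mp hS) p hp k X f a b c inferInstance

/-- summit ⇒ `DescentReducedToIntegral` (0551; proved in the tree anyway). [folklore] -/
theorem summit_imp_descentReducedToIntegral :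
    _root_.ResolutionOfSingularities → Theses.Descent.DescentReducedToIntegral :=
  fun _ => Theses.Descent.DescentReducedToIntegral_holds

/-- Hence: refuting the companion crux 0550 also costs a summit counterexample. [folklore] -/
theorem not_summit_of_not_descentAlgclosedToPerfect (h : ¬ Theses.Descent.DescentAlgclosedToPerfect) :
    ¬ _root_.ResolutionOfSingularities :=
  negDominated summit_imp_descentAlgclosedToPerfect h

/-- … and refuting rung B costs one (restated by name on the Descent route's own decl). [folklore] -/
theorem not_summit_of_not_descentPerfectToAll (h : ¬ Theses.Descent.DescentPerfectToAll) :
    ¬ _root_.ResolutionOfSingularities :=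
  negDominated summit_imp_descentPerfectToAll h

end Summit.ResolutionOfSingularities.ResolutionOfSingularities.Cruxes.DescentPerfectToAll.NegationLens6

end
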